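import Summits.RiemannHypothesis.RiemannHypothesis.Theorems.RuelleBandExactFirstBandStubHeatSummable
import Summits.RiemannHypothesis.RiemannHypothesis.Theorems.RuelleBandExactFirstBandStubHeatBounded
import Summits.RiemannHypothesis.RiemannHypothesis.Theorems.RuelleBandExactFirstBandStubTransfer
import Summits.RiemannHypothesis.RiemannHypothesis.Theorems.RuelleBandExactFirstBandStubExactHeatPD
import Summits.RiemannHypothesis.RiemannHypothesis.Theorems.RuelleBandExactFirstBandStubExpConvexDirichletReal
import HarnessLib

/-!
# Stub `stub_heatCone_iff` (line `Sketch`, heat cone) for the crux `RuelleBand.ExactFirstBand`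
(item stmt-RiemannHypothesis-2061): the bet is EXACTLY the crux

**Theorem.** Positive definiteness of the zero heat trace `t ↦ Re Σ_ρ m(ρ) e^{-t ρ(1-ρ)}` on the
semigroup `((0,∞),+)` (matrix positivity for real coefficients — the line's single research stub
`stub_heatPD`) is EQUIVALENT to the crux X "every zero of `ζ` in the open strip lies on the critical
line or on the real axis" (stated unfolded).

`→`: boundedness on `[t₀,∞)` is free (`stub_heatBounded`), so the heat trace is a bounded
positive-definite function; the engine `stub_expConvexDirichlet_real` (exponentially convex locally
finite Dirichlet series have real exponents) transferred to `ζ` (`stub_transfer`, with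
`stub_heatSummable`) gives X.  `←`: the calibration `stub_exact_heatPD` (under X every `ρ(1-ρ)` is real
and the quadratic form is a sum of squares).  All five ingredients are landed theorems of this line;
this file only assembles them.  Consequently the bet carries exactly the arithmetic content of X
(hence of RH, `Negative.exactFirstBand_iff_riemannHypothesis`) — no hidden strengthening, no slack.
-/

set_option linter.dupNamespace false

noncomputable section

open Complex
open scoped BigOperators

namespace Summit.RiemannHypothesis.RiemannHypothesis.Theorems.RuelleBandExactFirstBand

open Literature.NumberTheory.LFunctions
open Literature.Analysis.OperatorTheory
open Summit.RiemannHypothesis.RiemannHypothesis.Theses.RuelleBand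

/-- **Stub `stub_heatCone_iff`** (registered signature): positive definiteness of the zero heat trace
on `((0,∞),+)` ⟺ X (unfolded).  Assembly of the landed stubs `stub_heatBounded`, `stub_heatSummable`,
`stub_expConvexDirichlet_real`, `stub_transfer` (→) and `stub_exact_heatPD` (←). [folklore] -/
theorem stub_heatCone_iff :
    (∀ (n : ℕ) (s c : Fin n → ℝ), (∀ a, 0 < s a) →
      0 ≤ ∑ a, ∑ b, c a * c b *
        (∑' ρ : ZetaZeros.riemannZetaNontrivialZeros,
          (riemannZetaZeroOrder (ρ : ℂ) : ℂ) *
            cexp (-(((s a + s b : ℝ) : ℂ) * ((ρ : ℂ) * (1 - (ρ : ℂ)))))).re) ↔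
    (∀ s : ℂ, riemannZeta s = 0 → 0 < s.re → s.re < 1 → s.re = 1 / 2 ∨ s.im = 0) := by
  constructor
  · intro hPD
    exact stub_transfer stub_expConvexDirichlet_real stub_heatSummable ⟨hPD, stub_heatBounded⟩
  · intro hX
    exact stub_exact_heatPD stub_heatSummable hX

end Summit.RiemannHypothesis.RiemannHypothesis.Theorems.RuelleBandExactFirstBand

end
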